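import Mathlib
import Literature.LinearAlgebra.MeshulamMaximalRank
import HarnessLib

/-!
# Meshulam 1985: a linear space of `n × n` matrices over ANY field in which every matrix has rank
# `≤ r` has dimension `≤ r·n` (Flanders' bound without restriction on the field) — NAMED FACT

Topic `Literature/LinearAlgebra` (cell qa-qnc0, seat qa-qnc0-lit gen 10; ask R5-c of planner
qa-qnc0-p2's ROUND-5: THEOREM E3 of the tensor line of crux `RingToElim` bounds the quadratic layer
`A₂/A₃` of a radius system by "Meshulam: dim ≤ r·n" applied to a linear space of alternating `m × m`
matrices over `𝔽₂` of rank `≤ 6`).  Companion of `Literature.LinearAlgebra.DieudonneSingularSubspaces`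
(`Flanders.finrank_le_rank_mul_of_forall_rank_le`: the same bound PROVED over `ℂ` by Flanders'
continuity argument, whose header records "TODO(general form): … any field (Meshulam 1985)" — the
continuity/zeros-of-polynomials route needs `|F| > r` and does not reach `𝔽₂`).

## The source, verbatim (held `paper:doi-10-1093-qmath-36-2-225`, bib key `Meshulam1985`)

R. Meshulam, *On the maximal rank in a subspace of matrices*, Quart. J. Math. Oxford (2) 36 (1985)
225–229.  p. 225: «Let `M_n(F)` be the space of `n × n` matrices over a field `F`, and let `W` be a
linear subspace of `M_n(F)`.  Flanders [2] proved that if `dim W > rn` and `|F| ≥ r + 1`, then `W`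
contains a matrix of rank `> r`. … In this note we prove a lower bound on the maximal rank attained in a
subspace of matrices (Theorem 1). We then use this bound to derive Flanders' results (Theorems 2 and 3)
without restrictions on `F`.»  p. 226: «The next result had been proved by Flanders [2], for
`|F| ≥ r + 1`: **THEOREM 2.** If `W` is a subspace of `M_n(F)`, and `dim W > rn`, then `W` contains a
matrix of rank `> r`.»  (Proof, ibid.: Gaussian elimination makes the lexicographically first non-zero
entries `p(A₁), …, p(A_t)` of a basis distinct; `t > rn` positions cannot be covered by `r` lines, so
by Kőnig's theorem `r + 1` of them are independent, and Theorem 1 — an `r+1 × r+1` minor argument with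
a `0`–`1` combination found by induction — produces a member of rank `≥ r + 1`.)  Secondary restatement:
C. de Seguins Pazzis, *The classification of large spaces of matrices with bounded rank*, Israel J.
Math. (2015) = arXiv:1004.0298 (held), §1 p. 2: «This theorem was later generalized by Flanders to
subspaces of `Mat_{n,p}(𝕂)` with rank `≤ r` in the case `card 𝕂 > r`, proving in particular that such
a subspace must have a dimension lesser or equal to `r·max(n,p)` (later, Meshulam generalized this to
an arbitrary field …).»

## Contents

* `Meshulam1985_exists_rank_gt F` — THEOREM 2 as printed, for the field `F` (square matrices indexed by
  `Fin n`): NAMED FACT `def … : Prop` (not proved here; SIZE L: Kőnig's min-max theorem for bipartite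
  line covers is not in Mathlib, plus the echelon-basis and the inductive `0`–`1`-combination determinant
  steps of Theorem 1 — ≈ 500 lines; recorded as the discharge route).
  UPDATE 2026-08-27: DISCHARGED — `Meshulam1985_exists_rank_gt_holds` (appended
  2026-08-27 by the same seat) proves it from `MeshulamMaximalRank.lean` (Meshulam's Theorem 1 and Claim 1,
  proved there), following the printed proof of Theorem 2 with two bookkeeping simplifications: instead of
  Gaussian elimination we bound `dim W ≤ #{p(A) : A ∈ W ∖ 0}` by the injectivity of restriction to the
  leading positions, and instead of Kőnig's theorem we use the pigeonhole `Meshulam.exists_indep_of_card_gt`.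
* `finrank_le_mul_of_forall_rank_le` — the contrapositive "all ranks `≤ r` ⇒ `dim W ≤ r·n`" (the form
  the cell uses), PROVED from the fact.
* `finrank_le_mul_card_of_forall_rank_le` — the same for matrices indexed by an arbitrary `Fintype`
  (reindexing along `Fintype.equivFin`), PROVED from the fact.

TODO(general form): rectangular `n × p` matrices (`dim ≤ r·max(n,p)`, [Flanders1962]/[Meshulam1985]
via padding) and the equality case THEOREM 3 (`W = E ⊗ Fⁿ` or `Fⁿ ⊗ E`) are not vendored.
WHAT THIS IS NOT: Theorem 3 (equality case) and the rectangular form are not here; nothing bears on any summit statement.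
-/

namespace Literature.LinearAlgebra

open Module Matrix

/-- **Meshulam 1985, Theorem 2** (Flanders' bound over an arbitrary field): if `W` is a linear
subspace of `M_n(F)` with `dim W > r·n`, then `W` contains a matrix of rank `> r`.
[cite: Meshulam1985, Thm. 2 (p. 226); restated deSeguinsPazzis2015 = arXiv:1004.0298 §1 p. 2] -/
def Meshulam1985_exists_rank_gt (F : Type*) [Field F] : Prop :=
  ∀ (n r : ℕ) (W : Submodule F (Matrix (Fin n) (Fin n) F)),
    r * n < finrank F W → ∃ A ∈ W, r < A.rank

/-- **Corollary (the form used in applications):** over any field, a linear space of `n × n` matrices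
all of rank `≤ r` has dimension `≤ r·n`. [cite: Meshulam1985, Thm. 2 (p. 226), contrapositive] -/
theorem finrank_le_mul_of_forall_rank_le {F : Type*} [Field F] (h : Meshulam1985_exists_rank_gt F)
    {n r : ℕ} (W : Submodule F (Matrix (Fin n) (Fin n) F)) (hW : ∀ A ∈ W, A.rank ≤ r) :
    finrank F W ≤ r * n := by
  by_contra hlt
  obtain ⟨A, hA, hr⟩ := h n r W (lt_of_not_ge hlt)
  exact absurd (hW A hA) (not_le.2 hr)

/-- The same bound for square matrices indexed by an arbitrary finite type `ι` (`dim W ≤ r·|ι|`),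
by reindexing along `Fintype.equivFin ι`. [cite: Meshulam1985, Thm. 2 (p. 226), contrapositive] -/
theorem finrank_le_mul_card_of_forall_rank_le {F : Type*} [Field F] (h : Meshulam1985_exists_rank_gt F)
    {ι : Type*} [Fintype ι] [DecidableEq ι] {r : ℕ} (W : Submodule F (Matrix ι ι F))
    (hW : ∀ A ∈ W, A.rank ≤ r) : finrank F W ≤ r * Fintype.card ι := by
  classical
  set e := Fintype.equivFin ι with he
  -- reindex `ι ≃ Fin |ι|`: a linear equivalence of matrix spaces preserving the rank
  let φ : Matrix ι ι F ≃ₗ[F] Matrix (Fin (Fintype.card ι)) (Fin (Fintype.card ι)) F :=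
    Matrix.reindexLinearEquiv F F e e
  have hmap : ∀ A ∈ W.map φ.toLinearMap, A.rank ≤ r := by
    intro A hA
    obtain ⟨B, hB, rfl⟩ := Submodule.mem_map.1 hA
    change (Matrix.reindexLinearEquiv F F e e B).rank ≤ r
    rw [Matrix.coe_reindexLinearEquiv, Matrix.rank_reindex]
    exact hW B hB
  have h1 := finrank_le_mul_of_forall_rank_le h (W.map φ.toLinearMap) hmap
  rwa [LinearEquiv.finrank_map_eq] at h1

/-- **Meshulam 1985, Theorem 2 — PROVED** (discharge of the named fact): over any field, a subspace
`W ≤ M_n(F)` with `dim W > r·n` contains a matrix of rank `> r`.  Proof as printed (p. 226): the leading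
positions `p(A)`, `A ∈ W ∖ 0`, number at least `dim W > r·n` (restriction of `W` to these coordinates is
injective), hence contain `r + 1` independent ones (`Meshulam.exists_indep_of_card_gt`, replacing Kőnig), and
Theorem 1 (`Meshulam.exists_rank_ge_of_leading_indep`) gives a member of rank `≥ r + 1`.
[cite: Meshulam1985, Thm. 2 (p. 226)] -/
theorem Meshulam1985_exists_rank_gt_holds : ∀ (F : Type*) [Field F], Meshulam1985_exists_rank_gt F := by
  intro F _
  classical
  intro n r W hW
  -- support (in lexicographic coordinates) of a matrix, and the leading positions of `W ∖ 0`
  let supp : Matrix (Fin n) (Fin n) F → Finset (Lex (Fin n × Fin n)) :=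
    fun A => Finset.univ.filter fun q => A (ofLex q).1 (ofLex q).2 ≠ 0
  have hsupp : ∀ A q, q ∈ supp A ↔ A (ofLex q).1 (ofLex q).2 ≠ 0 := fun A q => by
    simp only [supp, Finset.mem_filter, Finset.mem_univ, true_and]
  let P : Finset (Lex (Fin n × Fin n)) :=
    Finset.univ.filter fun q => ∃ A ∈ W, (supp A).min = (q : WithTop (Lex (Fin n × Fin n)))
  have hP : ∀ q, q ∈ P ↔ ∃ A ∈ W, (supp A).min = (q : WithTop (Lex (Fin n × Fin n))) := fun q => by
    simp only [P, Finset.mem_filter, Finset.mem_univ, true_and]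
  -- (i) `dim W ≤ #P`: restriction to the coordinates in `P` is injective on `W`
  have hcard : finrank F W ≤ P.card := by
    let φ : W →ₗ[F] (P → F) :=
      { toFun := fun A q => (A : Matrix (Fin n) (Fin n) F) (ofLex q.1).1 (ofLex q.1).2
        map_add' := fun A B => rfl
        map_smul' := fun c A => rfl }
    have hinj : Function.Injective φ := by
      rw [← LinearMap.ker_eq_bot, LinearMap.ker_eq_bot']
      intro A hA
      by_contra hne
      obtain ⟨i, j, hij⟩ : ∃ i j, (A : Matrix (Fin n) (Fin n) F) i j ≠ 0 := by
        by_contra h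
        push Not at h
        exact hne (Subtype.ext (Matrix.ext fun i j => h i j))
      have hmem : toLex (i, j) ∈ supp A := (hsupp _ _).2 hij
      obtain ⟨q, hq⟩ := Finset.min_of_mem hmem
      have hqP : q ∈ P := (hP q).2 ⟨A, A.2, hq⟩
      have hq_supp : q ∈ supp A := Finset.mem_of_min hq
      exact (hsupp _ _).1 hq_supp (congr_fun hA ⟨q, hqP⟩)
    calc finrank F W ≤ finrank F (P → F) := LinearMap.finrank_le_finrank_of_injective hinj
      _ = P.card := by rw [Module.finrank_pi, Fintype.card_coe]
  -- (ii) `r + 1` independent leading positions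
  have hPcard : r * n < (P.image fun q => ofLex q).card := by
    rw [Finset.card_image_of_injective _ ofLex.injective]
    exact lt_of_lt_of_le hW hcard
  obtain ⟨k, l, hk, hl, hmem⟩ := Meshulam.exists_indep_of_card_gt r _ hPcard
  -- (iii) matrices of `W` with these leading positions
  have hchoice : ∀ j : Fin (r + 1), ∃ A : Matrix (Fin n) (Fin n) F, A ∈ W ∧
      (supp A).min = ((toLex (k j, l j) : Lex (Fin n × Fin n)) : WithTop (Lex (Fin n × Fin n))) := by
    intro j
    obtain ⟨q, hqP, hq⟩ := Finset.mem_image.1 (hmem j)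
    obtain ⟨A, hAW, hA⟩ := (hP q).1 hqP
    refine ⟨A, hAW, ?_⟩
    rw [hA, ← hq]
    rfl
  choose A hAW hAmin using hchoice
  have hne : ∀ j, A j (k j) (l j) ≠ 0 := fun j => (hsupp _ _).1 (Finset.mem_of_min (hAmin j))
  have hbefore : ∀ j (q : Lex (Fin n × Fin n)), q < toLex (k j, l j) → A j (ofLex q).1 (ofLex q).2 = 0 := by
    intro j q hq
    by_contra h
    have hle := Finset.min_le ((hsupp _ _).2 h)
    rw [hAmin j] at hle
    exact absurd (WithTop.coe_le_coe.1 hle) (not_le.2 hq)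
  have hrow : ∀ j i, i < k j → A j i = 0 := fun j i hi => by
    funext c
    exact hbefore j (toLex (i, c)) (Prod.Lex.toLex_lt_toLex.2 (Or.inl hi))
  have hcol : ∀ j c, c < l j → A j (k j) c = 0 := fun j c hc =>
    hbefore j (toLex (k j, c)) (Prod.Lex.toLex_lt_toLex.2 (Or.inr ⟨rfl, hc⟩))
  -- (iv) Theorem 1
  obtain ⟨x, hx⟩ := Meshulam.exists_rank_ge_of_leading_indep A k l hk hl hne hrow hcol
  exact ⟨∑ j, x j • A j, W.sum_mem fun j _ => W.smul_mem _ (hAW j), hx⟩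

end Literature.LinearAlgebra
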